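import Summits.FinalStateConjecture.FinalStateConjecture.Theorems.EIHFluxBalanceModulatedKerrHandoffDragKernel

/-!
# Route EIHFluxBalance — `ModulatedKerrHandoff`, stub `stub_dragEstimates`: the drag matrix

Helper file for the crux `stmt-FinalStateConjecture-10167`
(`Summit.FinalStateConjecture.FinalStateConjecture.Theses.EIHFluxBalance.ModulatedKerrHandoff`),
line `overlap-modulation-second-iterate`, stub `stub_dragEstimates`; continuation of `…DragKernel`.

The Lie drag of hole `i` is taken along `Xᵢ(y) = Aᵢ(y⁰)(y − cᵢ(y⁰))` with the DRAG MATRIX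
`Aᵢ(t) = ½ η⁻¹ Σ_{j ≠ i} (boostedKerrBilin (Λⱼ t) (t, ξⱼ t) Mⱼ aⱼ (t, ξᵢ t) − η)` — the other holes'
Kerr–Schild perturbations read at this hole's centre event (`η⁻¹` is `ContinuousLinearMap.inverse`
of `η♭`; only its operator norm enters).  This file bounds `t ↦ Aᵢ(t)` in `C³`:

* `ck_pairField` — ONE pair: `t ↦ boostedKerrBilin (Λⱼ t) (t, ξⱼ t) Mⱼ aⱼ (t, ξᵢ t) − η` has `C³` size
  `K_c / D_{ij}(t₀)` at `t₀`, `D_{ij} = ‖ξᵢ − ξⱼ‖ ≥ max 1 (2|aⱼ|)`: it is `D⁻¹ • 𝔉 ∘ q` for the kernel `𝔉`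
  and the parameter path `q(t) = (Mⱼ, Λⱼ(t)⁻¹, aⱼ/D, D⁻¹ S Λⱼ(t)⁻¹((t, ξᵢ t) − (t, ξⱼ t)))`, whose
  positive-order size is bounded by tameness AT `t₀` (`ck₁_paramMap`) and whose value lies in the
  kernel box with scaled radius `≥ 1/2` (`half_le_radius_pair`: boosts stretch spatial vectors);
* `exists_ck_dragMatrix` — under hyperbolic separation `D_{ij}(t) ≥ v_{ij} t` the finite sum and the
  fixed operator `½ η⁻¹ ∘ ·` give `‖Aᵢ⁽ᵏ⁾(t₀)‖ ≤ K / t₀` (`k ≤ 3`) for all late `t₀`.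

Kerr–Schild 1965, §2–3 (the kernel); Dieudonné 1960, (8.12). [folklore]
-/

noncomputable section

-- `Summit.<S>.<S>.…` (single-problem summit, D-0017) trips core's duplicate-namespace linter.
set_option linter.dupNamespace false

open Set Filter Function Literature.Geometry.Lorentzian
open scoped Topology ContDiff BigOperators

namespace Summit.FinalStateConjecture.FinalStateConjecture.Theorems

namespace Drag

open OneHole

/-! ### One pair: the field of hole `j` read along the centre of hole `i` -/

section Pair

variable {Λ : ℝ → lorentzGroup} {ξ ζ : ℝ → E3} {A Cθ : ℝ}

/-- **Size of the inverse frame as a function of lab time.** With `‖(Λ⁻¹)⁽ᵏ⁾‖ ≤ C_θ ‖Λ⁽ᵏ⁾‖` and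
`‖Λ⁽ᵏ⁾(t₀)‖ ≤ A` for `k ≤ 4`, `t ↦ Λ(t)⁻¹` has `C³` size `C_θ A` at `t₀`. [folklore] -/
theorem ck_theta (hΛ : ContDiff ℝ ∞ (fun t ↦ ((Λ t : E4 ≃L[ℝ] E4) : E4 →L[ℝ] E4))) (hC0 : 0 ≤ Cθ)
    (hCθ : ∀ (k : ℕ) (u : ℝ),
      ‖iteratedDeriv k (fun t ↦ (((Λ t : E4 ≃L[ℝ] E4).symm : E4 ≃L[ℝ] E4) : E4 →L[ℝ] E4)) u‖ ≤
        Cθ * ‖iteratedDeriv k (fun t ↦ ((Λ t : E4 ≃L[ℝ] E4) : E4 →L[ℝ] E4)) u‖)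
    {t₀ : ℝ} (hA : ∀ k ≤ 4, ‖iteratedDeriv k (fun t ↦ ((Λ t : E4 ≃L[ℝ] E4) : E4 →L[ℝ] E4)) t₀‖ ≤ A) :
    ContDiffAt ℝ 3 (fun t ↦ (((Λ t : E4 ≃L[ℝ] E4).symm : E4 ≃L[ℝ] E4) : E4 →L[ℝ] E4)) t₀ ∧
      ∀ i ≤ 3, ‖iteratedFDeriv ℝ i
        (fun t ↦ (((Λ t : E4 ≃L[ℝ] E4).symm : E4 ≃L[ℝ] E4) : E4 →L[ℝ] E4)) t₀‖ ≤ Cθ * A :=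
  ck_of_iteratedDeriv (n := 3) ((contDiff_theta hΛ).of_le (WithTop.coe_le_coe.mpr le_top)).contDiffAt
    fun i hi ↦ (hCθ i t₀).trans (mul_le_mul_of_nonneg_left (hA i (hi.trans (by norm_num))) hC0)

/-- **Size of the displacement between two simultaneous centre events** `t ↦ (t, ζ t) − (t, ξ t)`:
value `‖ζ(t₀) − ξ(t₀)‖`, derivatives of orders `1 … 3` at `t₀` bounded by `2 + 2A` when
`‖ζ⁽ᵏ⁾(t₀)‖, ‖ξ⁽ᵏ⁾(t₀)‖ ≤ A` (`1 ≤ k ≤ 4`). [folklore] -/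
theorem ck₁_centre_sub (hζ : ContDiff ℝ ∞ ζ) (hξ : ContDiff ℝ ∞ ξ) {t₀ : ℝ}
    (hAζ : ∀ k, 1 ≤ k → k ≤ 4 → ‖iteratedDeriv k ζ t₀‖ ≤ A)
    (hAξ : ∀ k, 1 ≤ k → k ≤ 4 → ‖iteratedDeriv k ξ t₀‖ ≤ A) :
    (ContDiffAt ℝ 3 (fun t ↦ E4.ofTimeSpace t (ζ t) - E4.ofTimeSpace t (ξ t)) t₀ ∧
      ∀ i, 1 ≤ i → i ≤ 3 →
        ‖iteratedFDeriv ℝ i (fun t ↦ E4.ofTimeSpace t (ζ t) - E4.ofTimeSpace t (ξ t)) t₀‖ ≤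
          2 + 2 * A) ∧
      ‖E4.ofTimeSpace t₀ (ζ t₀) - E4.ofTimeSpace t₀ (ξ t₀)‖ = ‖ζ t₀ - ξ t₀‖ := by
  have hcζ := ck₁_of_iteratedDeriv (n := 3) (C := 1 + A)
    ((contDiff_centre hζ).of_le (WithTop.coe_le_coe.mpr le_top)).contDiffAt
    (fun i hi1 hi ↦ (norm_iteratedDeriv_centre_le hζ t₀ hi1 (WithTop.coe_le_coe.mpr le_top)).trans
      (by linarith [hAζ i hi1 (hi.trans (by norm_num))]))
  have hcξ := ck₁_of_iteratedDeriv (n := 3) (C := 1 + A)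
    ((contDiff_centre hξ).of_le (WithTop.coe_le_coe.mpr le_top)).contDiffAt
    (fun i hi1 hi ↦ (norm_iteratedDeriv_centre_le hξ t₀ hi1 (WithTop.coe_le_coe.mpr le_top)).trans
      (by linarith [hAξ i hi1 (hi.trans (by norm_num))]))
  refine ⟨ck₁_mono (ck₁_sub hcζ hcξ) le_rfl (by linarith), ?_⟩
  have h := (sub_ofTimeSpace_apply_zero (x := E4.ofTimeSpace t₀ (ζ t₀)) rfl (ξ t₀)).2
  rwa [E4.spatial_ofTimeSpace] at h

/-- **The scaled rest-frame radius of one centre seen from the other hole is at least `1/2`** once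
`D = ‖ζ(t₀) − ξ(t₀)‖ ≥ max 1 (2|a|)` (`r² ≥ D² − a²`: boosts stretch spatial vectors; scale `D⁻¹`).
[folklore] -/
theorem half_le_radius_pair (a : ℝ) {t₀ : ℝ} (hD1 : 1 ≤ ‖ζ t₀ - ξ t₀‖) (haD : 2 * |a| ≤ ‖ζ t₀ - ξ t₀‖) :
    1 / 2 ≤ Kerr.radius (‖ζ t₀ - ξ t₀‖⁻¹ * a) (E4.ofTimeSpace 0 (‖ζ t₀ - ξ t₀‖⁻¹ •
      E4.spatial ((((Λ t₀ : E4 ≃L[ℝ] E4).symm : E4 ≃L[ℝ] E4) : E4 →L[ℝ] E4)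
        (E4.ofTimeSpace t₀ (ζ t₀) - E4.ofTimeSpace t₀ (ξ t₀))))) := by
  have hD0 : 0 < ‖ζ t₀ - ξ t₀‖ := one_pos.trans_le hD1
  rw [radius_scaledPosition (inv_pos.mpr hD0)]
  have h1 := sq_sub_sq_le_radius_poincareInv_sq (Λ t₀) a t₀ (ξ t₀) (x := E4.ofTimeSpace t₀ (ζ t₀))
    (E4.ofTimeSpace_apply_zero t₀ _)
  rw [E4.spatial_ofTimeSpace] at h1
  have hr0 := Kerr.radius_nonneg a (poincareInv (Λ t₀) (E4.ofTimeSpace t₀ (ξ t₀)) (E4.ofTimeSpace t₀ (ζ t₀)))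
  have hrr : Kerr.radius a ((((Λ t₀ : E4 ≃L[ℝ] E4).symm : E4 ≃L[ℝ] E4) : E4 →L[ℝ] E4)
      (E4.ofTimeSpace t₀ (ζ t₀) - E4.ofTimeSpace t₀ (ξ t₀))) =
      Kerr.radius a (poincareInv (Λ t₀) (E4.ofTimeSpace t₀ (ξ t₀)) (E4.ofTimeSpace t₀ (ζ t₀))) := rfl
  rw [hrr, le_inv_mul_iff₀ hD0]
  have ha2 : a ^ 2 ≤ ‖ζ t₀ - ξ t₀‖ ^ 2 / 4 := by
    rw [← sq_abs a]; nlinarith [abs_nonneg a]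
  have hr2 : (‖ζ t₀ - ξ t₀‖ / 2) ^ 2 ≤
      Kerr.radius a (poincareInv (Λ t₀) (E4.ofTimeSpace t₀ (ξ t₀)) (E4.ofTimeSpace t₀ (ζ t₀))) ^ 2 := by
    nlinarith
  have hrD := (sq_le_sq₀ (by positivity) hr0).mp hr2
  linarith

/-- **Size of the other hole's field along this hole's centre.** For hole `(M, a)` with tame moduli
`(Λ, ξ)` and a tame curve `ζ` (all bounds AT `t₀`), separated by `D = ‖ζ(t₀) − ξ(t₀)‖ ≥ max 1 (2|a|)`,
the field `t ↦ boostedKerrBilin (Λ t) (t, ξ t) M a (t, ζ t) − η` has `C³` size `K_c / D` at `t₀`,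
`K_c = 6 B (max 1 D_q)³`, `D_q = max (C_θA) (8 C_θA (2 + 2A))`, where `B` bounds the kernel on a
parameter box containing `(M, Λ(t₀)⁻¹, a/D, D⁻¹ S Λ(t₀)⁻¹((t₀, ζ t₀) − (t₀, ξ t₀)))`
(kernel identity with scale `D⁻¹`, Faà di Bruno). [folklore] -/
theorem ck_pairField (M a : ℝ) (hΛ : ContDiff ℝ ∞ (fun t ↦ ((Λ t : E4 ≃L[ℝ] E4) : E4 →L[ℝ] E4)))
    (hC0 : 0 ≤ Cθ)
    (hCθ : ∀ (k : ℕ) (u : ℝ),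
      ‖iteratedDeriv k (fun t ↦ (((Λ t : E4 ≃L[ℝ] E4).symm : E4 ≃L[ℝ] E4) : E4 →L[ℝ] E4)) u‖ ≤
        Cθ * ‖iteratedDeriv k (fun t ↦ ((Λ t : E4 ≃L[ℝ] E4) : E4 →L[ℝ] E4)) u‖)
    (hζ : ContDiff ℝ ∞ ζ) (hξ : ContDiff ℝ ∞ ξ) (hA0 : 0 ≤ A) {t₀ : ℝ}
    (hAΛ : ∀ k ≤ 4, ‖iteratedDeriv k (fun t ↦ ((Λ t : E4 ≃L[ℝ] E4) : E4 →L[ℝ] E4)) t₀‖ ≤ A)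
    (hAζ : ∀ k, 1 ≤ k → k ≤ 4 → ‖iteratedDeriv k ζ t₀‖ ≤ A)
    (hAξ : ∀ k, 1 ≤ k → k ≤ 4 → ‖iteratedDeriv k ξ t₀‖ ≤ A)
    {B Mb Lb ab Rb rb : ℝ}
    (hB : ∀ p : ℝ × ((E4 →L[ℝ] E4) × (ℝ × E3)),
      |p.1| ≤ Mb → ‖p.2.1‖ ≤ Lb → |p.2.2.1| ≤ ab → ‖p.2.2.2‖ ≤ Rb →
      rb ≤ Kerr.radius p.2.2.1 (E4.ofTimeSpace 0 p.2.2.2) →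
      ContDiffAt ℝ 4 (fun p : ℝ × ((E4 →L[ℝ] E4) × (ℝ × E3)) ↦
        (Kerr.bilin p.1 p.2.2.1 (E4.ofTimeSpace 0 p.2.2.2) - Minkowski.bilin).bilinearComp p.2.1 p.2.1) p ∧
      ∀ i ≤ 4, ‖iteratedFDeriv ℝ i (fun p : ℝ × ((E4 →L[ℝ] E4) × (ℝ × E3)) ↦
        (Kerr.bilin p.1 p.2.2.1 (E4.ofTimeSpace 0 p.2.2.2) - Minkowski.bilin).bilinearComp p.2.1 p.2.1) p‖
        ≤ B)
    (hM : |M| ≤ Mb) (hL : Cθ * A ≤ Lb) (ha : |a| ≤ ab) (hR : Cθ * A ≤ Rb) (hrb : rb ≤ 1 / 2)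
    (hD1 : 1 ≤ ‖ζ t₀ - ξ t₀‖) (haD : 2 * |a| ≤ ‖ζ t₀ - ξ t₀‖) :
    ContDiffAt ℝ 3 (fun t ↦ boostedKerrBilin (Λ t) (E4.ofTimeSpace t (ξ t)) M a (E4.ofTimeSpace t (ζ t))
      - Minkowski.bilin) t₀ ∧
      ∀ k ≤ 3, ‖iteratedFDeriv ℝ k (fun t ↦ boostedKerrBilin (Λ t) (E4.ofTimeSpace t (ξ t)) M a
        (E4.ofTimeSpace t (ζ t)) - Minkowski.bilin) t₀‖ ≤
        6 * B * max 1 (max (Cθ * A) (8 * (Cθ * A) * max 1 (2 + 2 * A))) ^ 3 / ‖ζ t₀ - ξ t₀‖ := by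
  set 𝔉 : ℝ × ((E4 →L[ℝ] E4) × (ℝ × E3)) → E4 →L[ℝ] E4 →L[ℝ] ℝ := fun p ↦
    (Kerr.bilin p.1 p.2.2.1 (E4.ofTimeSpace 0 p.2.2.2) - Minkowski.bilin).bilinearComp p.2.1 p.2.1 with h𝔉
  set D : ℝ := ‖ζ t₀ - ξ t₀‖ with hD
  have hD0 : 0 < D := one_pos.trans_le hD1
  set ε : ℝ := D⁻¹ with hε
  have hε0 : 0 < ε := inv_pos.mpr hD0
  have hε1 : ε ≤ 1 := inv_le_one_of_one_le₀ hD1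
  have hεD : ε * D ≤ 1 := (inv_mul_cancel₀ hD0.ne').le
  -- the parameter map
  have hθ := ck_theta hΛ hC0 hCθ hAΛ
  obtain ⟨hW, hWval⟩ := ck₁_centre_sub hζ hξ hAζ hAξ
  have hq := ck₁_paramMap (Θ := fun t ↦ (((Λ t : E4 ≃L[ℝ] E4).symm : E4 ≃L[ℝ] E4) : E4 →L[ℝ] E4))
    (W := fun t ↦ E4.ofTimeSpace t (ζ t) - E4.ofTimeSpace t (ξ t)) (x := t₀) M (ε * a) hθ hW
    hWval.le (by positivity) hε0.le hε1 hεD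
  -- the parameter point lies in the box
  have hθ0 : ‖(((Λ t₀ : E4 ≃L[ℝ] E4).symm : E4 ≃L[ℝ] E4) : E4 →L[ℝ] E4)‖ ≤ Cθ * A := by
    have h := hθ.2 0 (Nat.zero_le _)
    rwa [norm_iteratedFDeriv_zero] at h
  have hBq := hB (M, ((((Λ t₀ : E4 ≃L[ℝ] E4).symm : E4 ≃L[ℝ] E4) : E4 →L[ℝ] E4),
      (ε * a, ε • E4.spatial ((((Λ t₀ : E4 ≃L[ℝ] E4).symm : E4 ≃L[ℝ] E4) : E4 →L[ℝ] E4)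
        (E4.ofTimeSpace t₀ (ζ t₀) - E4.ofTimeSpace t₀ (ξ t₀)))))) hM (hθ0.trans hL)
    (by rw [abs_mul, abs_of_pos hε0]; exact (mul_le_of_le_one_left (abs_nonneg a) hε1).trans ha)
    ((norm_scaledPosition_le hθ0 hWval.le hε0.le hεD).trans hR)
    (hrb.trans (half_le_radius_pair a hD1 haD))
  have hF := ck_kernel_comp (𝔉 := 𝔉) (x := t₀)
    (p := fun t ↦ ((M, ((((Λ t : E4 ≃L[ℝ] E4).symm : E4 ≃L[ℝ] E4) : E4 →L[ℝ] E4),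
      (ε * a, ε • E4.spatial ((((Λ t : E4 ≃L[ℝ] E4).symm : E4 ≃L[ℝ] E4) : E4 →L[ℝ] E4)
        (E4.ofTimeSpace t (ζ t) - E4.ofTimeSpace t (ξ t)))))) : ℝ × ((E4 →L[ℝ] E4) × (ℝ × E3))))
    hBq hq
  have hc := ck_const_smul hF ε
  -- the kernel identity along the pair
  have hid : (fun t ↦ boostedKerrBilin (Λ t) (E4.ofTimeSpace t (ξ t)) M a (E4.ofTimeSpace t (ζ t))
      - Minkowski.bilin) = fun t ↦ ε • 𝔉 ((M, ((((Λ t : E4 ≃L[ℝ] E4).symm : E4 ≃L[ℝ] E4) : E4 →L[ℝ] E4),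
        (ε * a, ε • E4.spatial ((((Λ t : E4 ≃L[ℝ] E4).symm : E4 ≃L[ℝ] E4) : E4 →L[ℝ] E4)
          (E4.ofTimeSpace t (ζ t) - E4.ofTimeSpace t (ξ t)))))) : ℝ × ((E4 →L[ℝ] E4) × (ℝ × E3))) :=
    funext fun t ↦ boostedKerrBilin_sub_eq_smul_kernel (Λ t) _ M a hε0 _
  rw [hid]
  refine ck_mono hc le_rfl (le_of_eq ?_)
  rw [abs_of_pos hε0, hε, inv_mul_eq_div]

end Pair

/-! ### The drag matrix of hole `i` -/

section Matrix

variable {N : ℕ} {M a : Fin N → ℝ} {Λ : Fin N → ℝ → lorentzGroup} {ξ : Fin N → ℝ → E3} {A Cθ τ₀ : ℝ}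

/-- **Size of the drag matrix.** Under smooth moduli, `‖(Λⱼ⁻¹)⁽ᵏ⁾‖ ≤ C_θ ‖Λⱼ⁽ᵏ⁾‖`, tameness after
`τ₀` (`‖Λⱼ⁽ᵏ⁾(t)‖ ≤ A`, `k ≤ 4`; `‖ξⱼ⁽ᵏ⁾(t)‖ ≤ A`, `1 ≤ k ≤ 4`) and hyperbolic separation, there are
`K ≥ 0` and `T` such that for every `t₀ ≥ T` the drag matrix
`t ↦ Aᵢ(t) = ½ η⁻¹ Σ_{j ≠ i} (boostedKerrBilin (Λⱼ t) (t, ξⱼ t) Mⱼ aⱼ (t, ξᵢ t) − η)` is `C³` at `t₀`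
with all derivatives of order `≤ 3` bounded by `K / t₀` (each pair field is `O(1/D_{ij}(t₀))` in `C³`
by `ck_pairField`, and `D_{ij}(t₀) ≥ v_{ij} t₀`). [folklore] -/
theorem exists_ck_dragMatrix
    (hΛ : ∀ j, ContDiff ℝ ∞ (fun t ↦ ((Λ j t : E4 ≃L[ℝ] E4) : E4 →L[ℝ] E4)))
    (hξ : ∀ j, ContDiff ℝ ∞ (ξ j)) (hC0 : 0 ≤ Cθ)
    (hCθ : ∀ j (k : ℕ) (u : ℝ),
      ‖iteratedDeriv k (fun t ↦ (((Λ j t : E4 ≃L[ℝ] E4).symm : E4 ≃L[ℝ] E4) : E4 →L[ℝ] E4)) u‖ ≤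
        Cθ * ‖iteratedDeriv k (fun t ↦ ((Λ j t : E4 ≃L[ℝ] E4) : E4 →L[ℝ] E4)) u‖)
    (htame : ∀ j t, τ₀ ≤ t →
      (∀ k, k ≤ 4 → ‖iteratedDeriv k (fun s ↦ ((Λ j s : E4 ≃L[ℝ] E4) : E4 →L[ℝ] E4)) t‖ ≤ A) ∧
        ∀ k, 1 ≤ k → k ≤ 4 → ‖iteratedDeriv k (ξ j) t‖ ≤ A)
    (hhyp : ∀ i j, i ≠ j → ∃ v : ℝ, 0 < v ∧ ∀ᶠ t in atTop, v * t ≤ ‖ξ i t - ξ j t‖) (i : Fin N) :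
    ∃ K T : ℝ, 0 ≤ K ∧ τ₀ ≤ T ∧ 1 ≤ T ∧ ∀ t₀, T ≤ t₀ →
      ContDiffAt ℝ 3 (fun t ↦ (2⁻¹ : ℝ) • ((Minkowski.bilin : E4 →L[ℝ] E4 →L[ℝ] ℝ).inverse.comp
        (∑ j ∈ Finset.univ.erase i, (boostedKerrBilin (Λ j t) (E4.ofTimeSpace t (ξ j t)) (M j) (a j)
          (E4.ofTimeSpace t (ξ i t)) - Minkowski.bilin)))) t₀ ∧
      ∀ k ≤ 3, ‖iteratedFDeriv ℝ k (fun t ↦ (2⁻¹ : ℝ) • ((Minkowski.bilin : E4 →L[ℝ] E4 →L[ℝ] ℝ).inverse.comp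
        (∑ j ∈ Finset.univ.erase i, (boostedKerrBilin (Λ j t) (E4.ofTimeSpace t (ξ j t)) (M j) (a j)
          (E4.ofTimeSpace t (ξ i t)) - Minkowski.bilin)))) t₀‖ ≤ K / t₀ := by
  -- separation data of the other holes
  have hsep : ∀ j, j ≠ i → ∃ v : ℝ, 0 < v ∧ ∀ᶠ t in atTop, v * t ≤ ‖ξ i t - ξ j t‖ :=
    fun j hj ↦ hhyp i j (Ne.symm hj)
  choose! v hv0 hv using hsep
  have hev : ∀ᶠ t in atTop, ∀ j, j ≠ i →
      v j * t ≤ ‖ξ i t - ξ j t‖ ∧ max 1 (2 * |a j|) ≤ ‖ξ i t - ξ j t‖ := by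
    refine eventually_all.mpr fun j ↦ ?_
    by_cases hj : j = i
    · exact Eventually.of_forall fun t h ↦ (h hj).elim
    · filter_upwards [hv j hj, eventually_ge_atTop (max 1 (2 * |a j|) / v j)] with t h1 h2 _
      refine ⟨h1, ?_⟩
      rw [div_le_iff₀ (hv0 j hj)] at h2
      linarith
  obtain ⟨T₁, hT₁⟩ := eventually_atTop.mp hev
  -- tameness makes `A ≥ 0` as soon as it is used; we only need it at late times
  obtain ⟨B, hB0, hB⟩ := exists_ck_kernel 4 (∑ j, |M j|) (Cθ * A) (∑ j, |a j|) (Cθ * A)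
    (by norm_num : (0 : ℝ) < 1 / 2)
  set Kc : ℝ := 6 * B * max 1 (max (Cθ * A) (8 * (Cθ * A) * max 1 (2 + 2 * A))) ^ 3 with hKc
  have hKc0 : 0 ≤ Kc := by positivity
  set S : ℝ := ∑ j ∈ Finset.univ.erase i, Kc / v j with hS
  have hS0 : 0 ≤ S := Finset.sum_nonneg fun j hj ↦ div_nonneg hKc0 (hv0 j (Finset.ne_of_mem_erase hj)).le
  refine ⟨4 * ‖(Minkowski.bilin : E4 →L[ℝ] E4 →L[ℝ] ℝ).inverse‖ * S, max T₁ (max τ₀ 1),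
    mul_nonneg (mul_nonneg (by norm_num)
      (norm_nonneg ((Minkowski.bilin : E4 →L[ℝ] E4 →L[ℝ] ℝ).inverse))) hS0,
    (le_max_left _ _).trans (le_max_right _ _), (le_max_right _ _).trans (le_max_right _ _),
    fun t₀ ht₀ ↦ ?_⟩
  have hT₁t : T₁ ≤ t₀ := (le_max_left _ _).trans ht₀
  have hτt : τ₀ ≤ t₀ := ((le_max_left _ _).trans (le_max_right _ _)).trans ht₀
  have ht1 : 1 ≤ t₀ := ((le_max_right _ _).trans (le_max_right _ _)).trans ht₀
  have ht0 : 0 < t₀ := one_pos.trans_le ht1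
  have hA0 : 0 ≤ A := (norm_nonneg _).trans ((htame i t₀ hτt).1 0 (Nat.zero_le _))
  -- each pair field
  have hpair : ∀ j ∈ Finset.univ.erase i,
      ContDiffAt ℝ 3 (fun t ↦ boostedKerrBilin (Λ j t) (E4.ofTimeSpace t (ξ j t)) (M j) (a j)
        (E4.ofTimeSpace t (ξ i t)) - Minkowski.bilin) t₀ ∧
      ∀ k ≤ 3, ‖iteratedFDeriv ℝ k (fun t ↦ boostedKerrBilin (Λ j t) (E4.ofTimeSpace t (ξ j t)) (M j)
        (a j) (E4.ofTimeSpace t (ξ i t)) - Minkowski.bilin) t₀‖ ≤ Kc / (v j * t₀) := by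
    intro j hj
    have hji : j ≠ i := Finset.ne_of_mem_erase hj
    obtain ⟨hvj, hmax⟩ := hT₁ t₀ hT₁t j hji
    have hD1 : 1 ≤ ‖ξ i t₀ - ξ j t₀‖ := (le_max_left _ _).trans hmax
    have haD : 2 * |a j| ≤ ‖ξ i t₀ - ξ j t₀‖ := (le_max_right _ _).trans hmax
    have hMj : |M j| ≤ ∑ j, |M j| :=
      Finset.single_le_sum (f := fun j ↦ |M j|) (fun _ _ ↦ abs_nonneg _) (Finset.mem_univ j)
    have haj : |a j| ≤ ∑ j, |a j| :=
      Finset.single_le_sum (f := fun j ↦ |a j|) (fun _ _ ↦ abs_nonneg _) (Finset.mem_univ j)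
    have h := ck_pairField (M j) (a j) (hΛ j) hC0 (hCθ j) (hξ i) (hξ j) hA0 (htame j t₀ hτt).1
      (htame i t₀ hτt).2 (htame j t₀ hτt).2 hB hMj le_rfl haj le_rfl le_rfl hD1 haD
    refine ck_mono h le_rfl ?_
    have hvt : 0 < v j * t₀ := mul_pos (hv0 j hji) ht0
    exact div_le_div_of_nonneg_left hKc0 hvt hvj
  have hsum := ck_sum (Finset.univ.erase i) hpair
  have hsum' : ∑ j ∈ Finset.univ.erase i, Kc / (v j * t₀) = S / t₀ := by
    rw [hS, Finset.sum_div]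
    exact Finset.sum_congr rfl fun j _ ↦ by rw [div_div]
  rw [hsum'] at hsum
  have hη := ck_const 3 ((Minkowski.bilin : E4 →L[ℝ] E4 →L[ℝ] ℝ).inverse) t₀
  have hcomp := ck_clm_comp hη hsum
  have hA := ck_const_smul hcomp (2⁻¹ : ℝ)
  refine ck_mono hA le_rfl (le_of_eq ?_)
  rw [abs_of_pos (by norm_num : (0 : ℝ) < 2⁻¹)]
  ring

end Matrix

end Drag

/-- Registered sub-goal form (stub `drag_half_le_radius_pair` of the crux item) of
`Drag.half_le_radius_pair`: the scaled rest-frame radius of one centre seen from another hole is at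
least `1/2` once the centres are `≥ max 1 (2|a|)` apart. [folklore] -/
theorem drag_half_le_radius_pair : open Literature.Geometry.Lorentzian in ∀ {Λ : ℝ → lorentzGroup} {ξ ζ : ℝ → E3} (a : ℝ) {t₀ : ℝ}, 1 ≤ ‖ζ t₀ - ξ t₀‖ → 2 * |a| ≤ ‖ζ t₀ - ξ t₀‖ → 1 / 2 ≤ Kerr.radius (‖ζ t₀ - ξ t₀‖⁻¹ * a) (E4.ofTimeSpace 0 (‖ζ t₀ - ξ t₀‖⁻¹ • E4.spatial ((((Λ t₀ : E4 ≃L[ℝ] E4).symm : E4 ≃L[ℝ] E4) : E4 →L[ℝ] E4) (E4.ofTimeSpace t₀ (ζ t₀) - E4.ofTimeSpace t₀ (ξ t₀))))) :=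
  fun a _ hD1 haD ↦ Drag.half_le_radius_pair a hD1 haD

end Summit.FinalStateConjecture.FinalStateConjecture.Theorems

end
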